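import Literature.NumberTheory.LFunctions.MertensThirdUpperChain
import HarnessLib

/-!
# RH-FREE kernel certificate — «nothing here bears on the truth of RH»
# Rosser–Schoenfeld's (3.29) below `3 659 203`: certified run of the product upper chain, chunks 16–17
# (primes `3196909 → 3659203`)

Topic: `Literature/NumberTheory/LFunctions`. Pure proof file (kernel computation; nothing is asserted, no definition).
Each `runK` evaluates `MertensThirdUpperChain.runD 15333` — `15333` steps along the prime table `ChainTable.table`,
each certifying the next prime `p'`, performing the comparison `cmp` behind (3.29)
`∏_{p ≤ x} p/(p−1) < e^γ log x (1 + 1/(2 log² x))` on `[p, p') ∩ [286, ∞)`, extending the enclosures of `log p'`,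
`log log p'`, and adding the upper enclosure of `log(p'/(p'−1))`. The four files `MertensThirdUpperChainRun1–4.lean`
(chunks 1–17, primes `3 → 3659203`) carry the certificate past Dusart's threshold `3 594 641`
(assembly: `MertensThirdUpperBound.lean`). The expected states were obtained by evaluating the same function compiled
(`#eval` on the Lean farm, 2026-08-28; all comparisons pass). `decide +kernel`, standard axioms only (`maxHeartbeats 0`).

## References
* J. B. Rosser, L. Schoenfeld, Illinois J. Math. 6 (1962), 64–94: Thm 8 (3.29), p. 70; §8 p. 87 (tables below 10⁸).
  [RosserSchoenfeld1962]
-/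

namespace Literature.NumberTheory.LFunctions.MertensThirdUpperChainRun

open MertensThirdUpperChain

set_option maxHeartbeats 0 in
/-- **Chunk 16 of the certified product upper run** (primes `3196909` to `3426623`).
[cite: RosserSchoenfeld1962, Thm. 8 (3.29) and §8 p. 87] -/
theorem run16 :
    runD 15333
      ⟨3196909, 18106922159628504133144670, 18106922159628979744800957,
        3272032787448044143646235, 3969889061063892384496273⟩ =
    some ⟨3426623, 18190810516713500659424769, 18190810516713976271435808,
        3277620738271044770256896, 3975488896720058267209130⟩ := by
  decide +kernel

set_option maxHeartbeats 0 in
/-- **Chunk 17 of the certified product upper run** (primes `3426623` to `3659203`).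
[cite: RosserSchoenfeld1962, Thm. 8 (3.29) and §8 p. 87] -/
theorem run17 :
    runD 15333
      ⟨3426623, 18190810516713500659424769, 18190810516713976271435808,
        3277620738271044770256896, 3975488896720058267209130⟩ =
    some ⟨3659203, 18270200839762343355071342, 18270200839762818967436958,
        3282885384020215079835869, 3980722508707392202320039⟩ := by
  decide +kernel

end Literature.NumberTheory.LFunctions.MertensThirdUpperChainRun
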